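import Literature.Topology.FourManifolds.SurfaceGroupSimpleCircuitRotate
import Literature.Topology.FourManifolds.SurfaceGroupNielsenAssembly
import Literature.GroupTheory.CombinatorialGroupTheory.FreeGroupCyclicConjugates
import HarnessLib

/-!
# Nielsen's theorem, pillar CORE: the reduction `NoDoublePoint ⇒ HomotopicSimple` closed

Topic `Literature/Topology/FourManifolds`.  The two closure properties left abstract in the CORE
frame (`SurfaceGroupNielsenCoreFrame.lean`) are discharged: rotations of simple circuits are
simple circuits (`simpleCircuitRotate_holds`, `SurfaceGroupSimpleCircuitRotate.lean`) and the
cyclic reductions of two conjugate elements of a free group are rotations of each other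
(`cyclicReductionOfConj_holds`, from the rotation lemma of `FreeGroupCyclicConjugates.lean`).
Hence `homotopicSimple_of_noDoublePoint'`: the CORE pillar `HomotopicSimple g` of Nielsen's
theorem (ZVC Thm. 5.3.2 + Cor. 5.3.5) follows from `NoDoublePoint g` (no double point on the
closed path of a potential-minimal configuration) alone; and, with the other four pillars,
Nielsen's theorem itself (`nielsen_of_noDoublePoint`).

## References

* H. Zieschang, E. Vogt, H.-D. Coldewey, *Surfaces and Planar Discontinuous Groups*, LNM 835
  (1980), Thm. 5.3.2, Cor. 5.3.5, Thm. 5.6.1. [ZieschangVogtColdewey1980]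
-/

noncomputable section

namespace Literature.Topology.FourManifolds

open Literature.GroupTheory.CombinatorialGroupTheory List

namespace SurfaceGroup

variable {g : ℕ}

/-- **Cyclic reductions of conjugates are rotations of each other** (`CyclicReductionOfConj g`
of the CORE frame). [folklore] -/
theorem cyclicReductionOfConj_holds (g : ℕ) : CyclicReductionOfConj g := by
  intro x d
  -- `x = e * mk C * e⁻¹` with `C` the cyclic reduction of `x`
  obtain ⟨e, he⟩ := exists_eq_conj_mk_reduceCyclically x
  set C := FreeGroup.reduceCyclically (FreeGroup.toWord x) with hC
  have hCred : FreeGroup.IsCyclicallyReduced C :=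
    FreeGroup.reduceCyclically.isCyclicallyReduced FreeGroup.isReduced_toWord
  have hx : d * x * d⁻¹ = (d * e) * FreeGroup.mk C * (d * e)⁻¹ := by rw [he]; group
  obtain ⟨k, hk⟩ := exists_rotate_eq_reduceCyclically_conj hCred (d * e)
  exact ⟨k, by rw [hx, hk]⟩

/-- **CORE from no-double-point alone.** [cite: ZieschangVogtColdewey1980, Thm. 5.3.2 and Cor. 5.3.5] -/
theorem homotopicSimple_of_noDoublePoint' (hN : NoDoublePoint g) : HomotopicSimple g :=
  homotopicSimple_of_noDoublePoint hN (cyclicReductionOfConj_holds g) (simpleCircuitRotate_holds g)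

/-- **Nielsen's theorem from no-double-point and the four landed-or-pending pillars.**
[cite: ZieschangVogtColdewey1980, Thm. 5.6.1] -/
theorem nielsen_of_noDoublePoint
    (H : ∀ g : ℕ, 2 ≤ g → BlockLemma g ∧ NoDoublePoint g ∧ SimpleCircuitRotation g ∧
      DegreeOfAut g ∧ RelatorEndIsAut g) :
    nielsen_surfaceGroup_mulEquiv_lift :=
  nielsen_of_pillars fun g hg =>
    let ⟨hA, hN, hB, hD, hE⟩ := H g hg
    ⟨hA, homotopicSimple_of_noDoublePoint' hN, hB, hD, hE⟩

end SurfaceGroup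

end Literature.Topology.FourManifolds

end
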